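import Mathlib.Topology.Algebra.OpenSubgroup
import Mathlib.Topology.Algebra.Group.Basic
import Mathlib.GroupTheory.Commensurable
import Mathlib.GroupTheory.DoubleCoset
import Mathlib.GroupTheory.Commutator.Basic
import Mathlib.GroupTheory.Index
import Mathlib.Algebra.Group.Subgroup.Pointwise
import Mathlib.Data.Sym.Sym2
import Mathlib.Data.Nat.Prime.Basic
import Mathlib.SetTheory.Cardinal.Finite
import HarnessLib

/-!
# Semi-graphs of anabelioids of PSC-type: the PSC-fundamental group interface ([CombGC] §1, Def. 1.1)

Mochizuki, *A combinatorial version of the Grothendieck conjecture*, Tohoku Math. J. **59**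
(2007) 455–479 [CombGC], §1 "Criterion for Graphicity", Definition 1.1 (i), (ii), author's
manuscript pp. 6–7 [cite: MochizukiCombGC2007, Def 1.1 pp.6-7]; this is the vocabulary that
[IUTchI] §1–§2 imports ("a semi-graph of anabelioids of pro-Σ PSC-type [cf. [CombGC],
Definition 1.1, (i)]", [IUTchI] p. 44).

## What is typed here and at what level

Definition 1.1 (i) defines a semi-graph of anabelioids `G` to be *of pro-Σ PSC-type* if it is the
pro-Σ completion of the semi-graph of anabelioids of the dual semi-graph of profinite groups with
compact structure of a pointed stable curve over an algebraically closed field of characteristic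
`∉ Σ`; (ii) attaches to it the *PSC-fundamental group* `Π_G` (maximal pro-Σ quotient of the
profinite fundamental group of `G`), the *verticial* / *edge-like* (*nodal*, *cuspidal*) closed
subgroups determined up to conjugation by the vertices / edges, the filtration
`M^cusp ⊆ M^edge ⊆ M^vert ⊆ M_G` of the abelianization, the quotients
`Π_G ↠ Π^cpt ↠ Π^unr ↠ Π^grph`, and the adjective *sturdy*.

Pointed stable curves, their dual semi-graphs, and the profinite fundamental group of a semi-graph
of anabelioids are not in the tree (FOUNDATIONS rows 11–14 of the abc-iut cell); general semi-graphs
(`SemiGraphs.SemiGraph`) and semi-graphs of anabelioids ([SemiAnbd] Def. 2.1) are the layer of seat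
abc-iut-L3-t1; the finite vertex/node/cusp presentation `PSCSemiGraph` below (the special shape of
Def. 1.1 (i)) is bridged to `SemiGraphs.SemiGraph` by `PSCSemiGraph.toSemiGraph` in
`PSCGraphicity.lean`.  Following the cell's STATEMENTS-FIRST rule ("absent deep inputs = INTERFACE structures whose axioms
quote print") this file therefore types Definition 1.1 as an **interface**: the structure
`PSCDatum Π` records exactly the data that Definition 1.1 (ii) extracts from a semi-graph of
anabelioids of PSC-type with PSC-fundamental group `Π` — the finite underlying semi-graph
(vertices, nodes = closed edges, cusps = open edges, coincidence maps), one representative of the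
conjugacy class of verticial / nodal / cuspidal subgroups per component, the set `Σ`, and the
genera of the irreducible components (Remark 1.1.5) — together with the properties of these data
that §1 states on pp. 6–8 and uses without further comment (closedness; the branch inclusions
`Π_e ↪ Π_v`; `Π_G` is pro-Σ).  Everything else in this file is DEFINED from that datum with
Mathlib's group theory:

* finite étale `Π_G`-coverings `G' → G` = open subgroups `H ≤ Π` ("Galois" = normal, [IUTchI]
  Rmk 1.2.3 (i)); cusps / nodes / vertices of `G'` = double cosets `H \ Π / Π_c` etc. (`H`-orbits
  of the cusps of the universal covering), whence `r(G')`, `n(G')`, `i(G')` (`cuspCount`, …);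
* verticial (etc.) subgroups of `Π_{G'} = H` = the `H ⊓ γ Π_v γ⁻¹`; the submodules `M^vert_{G'}`
  etc. of `M_{G'} = H^ab` are recorded by their inverse images in `H` (`vertFil`, `edgeFil`,
  `cuspFil`) — all that "filtration-preserving" (Def. 1.4 (iii)) needs;
* the kernels of `Π_G ↠ Π^cpt_G ↠ Π^unr_G ↠ Π^grph_G` (`cptKer ≤ unrKer ≤ grphKer`, both proved).

Deliberately NOT here: Def. 1.4 – Thm. 1.6 (`PSCGraphicity.lean`, `PSCRamification.lean`); Rmks.
1.1.1–1.1.6, Prop. 1.3; `Π^grph_G` as the pro-Σ completion of `π₁` of the semi-graph (Rmk. 1.1.3).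
*Sturdy* is typed through Rmk. 1.1.5 ("every irreducible component … of genus ≥ 2") rather than
through freeness of `B_v^ab` over `Ẑ^Σ` -- TODO(general form): Def. 1.1 (ii) prints "free of rank
≥ 2 over Ẑ^Σ", a MISPRINT corrected to "rank > 2" in Hoshi–Mochizuki [CbTpII] Rmk. 1.1.2 (bib
`HoshiMochizukiCbTpII2022`; it also records "sturdy iff every vertex is of genus ≥ 2").
"Commensurably terminal" ([CombGC] §0 p. 3) is the tree's `AbsoluteAnabelian.IsCommensurablyTerminal`
/ `Anabelioids.IsCommensurablyTerminal` (= Mathlib's `commensurator H = H`), not re-declared here.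
No statement of the paper is strengthened; nothing here takes a side on [IUTchIII] Cor. 3.12.
-/

namespace Literature.AnabelianGeometry.SemiGraphs

open scoped Pointwise

universe u

/-! ### The underlying semi-graph of a pointed stable curve (Def. 1.1 (i), p. 6) -/

/-- The underlying (finite) semi-graph `𝔾` of a semi-graph of anabelioids of PSC-type
([CombGC] Def. 1.1 (i), p. 6: "the vertices (respectively, closed edges; open edges) of `𝔾`
correspond to the irreducible components (respectively, nodes; cusps [i.e., marked points]) of the
pointed stable curve"; "we shall refer to the open (respectively, closed) edges … as the cusps
(respectively, nodes)").  Every edge of a semi-graph has two branches ([SemiAnbd] §1 p. 11); a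
node is a closed edge, both of whose branches abut to vertices (`nodeEnds e : Sym2 V`, the two —
not necessarily distinct — vertices it joins), a cusp is an open edge with exactly one verticial
branch (`cuspEnd`).  Bridged to the general `SemiGraphs.SemiGraph` (seat L3-t1) by
`PSCSemiGraph.toSemiGraph` (`PSCGraphicity.lean`). [cite: MochizukiCombGC2007, Def 1.1(i) p.6] -/
structure PSCSemiGraph : Type 1 where
  /-- vertices (irreducible components of the pointed stable curve) -/
  V : Type
  /-- nodes = closed edges -/
  N : Type
  /-- cusps = open edges (marked points) -/
  C : Type
  [fintypeV : Fintype V]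
  [fintypeN : Fintype N]
  [fintypeC : Fintype C]
  [decEqV : DecidableEq V]
  [decEqN : DecidableEq N]
  [decEqC : DecidableEq C]
  /-- the two vertices (possibly equal) to which the two branches of a node abut -/
  nodeEnds : N → Sym2 V
  /-- the vertex to which the unique verticial branch of a cusp abuts -/
  cuspEnd : C → V

attribute [instance] PSCSemiGraph.fintypeV PSCSemiGraph.fintypeN PSCSemiGraph.fintypeC
  PSCSemiGraph.decEqV PSCSemiGraph.decEqN PSCSemiGraph.decEqC

namespace PSCSemiGraph

/-- `r(G)`: the cardinality of the set of cusps (Def. 1.1 (i), p. 6).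
[cite: MochizukiCombGC2007, Def 1.1(i) p.6] -/
def r (𝔾 : PSCSemiGraph) : ℕ := Fintype.card 𝔾.C

/-- `n(G)`: the cardinality of the set of nodes (Def. 1.1 (i), p. 6).
[cite: MochizukiCombGC2007, Def 1.1(i) p.6] -/
def n (𝔾 : PSCSemiGraph) : ℕ := Fintype.card 𝔾.N

/-- `i(G)`: the cardinality of the set of vertices (Def. 1.1 (i), p. 6).
[cite: MochizukiCombGC2007, Def 1.1(i) p.6] -/
def i (𝔾 : PSCSemiGraph) : ℕ := Fintype.card 𝔾.V

/-- `G` is *noncuspidal* if `r(G) = 0` (Def. 1.1 (i), p. 6). [cite: MochizukiCombGC2007, Def 1.1(i) p.6] -/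
def IsNoncuspidal (𝔾 : PSCSemiGraph) : Prop := 𝔾.r = 0

/-- `G` is *nonnodal* if `n(G) = 0` (Def. 1.1 (i), p. 6). [cite: MochizukiCombGC2007, Def 1.1(i) p.6] -/
def IsNonnodal (𝔾 : PSCSemiGraph) : Prop := 𝔾.n = 0

/-- An isomorphism of the underlying semi-graphs: bijections on vertices, nodes and cusps
compatible with the coincidence maps ([SemiAnbd] §1 p. 11, "a morphism between semi-graphs … is a
collection of maps `V → V'`; `E → E'` … compatible with the verticial restrictions of the respective
coincidence maps").  (The bijection of branches of a loop is not recorded: it is invisible to every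
statement of [CombGC] §1 typed in the tree.) [cite: MochizukiSemiAnbd2006, §1 p.11] -/
structure Iso (𝔾 ℍ : PSCSemiGraph) where
  /-- bijection on vertices -/
  vertEquiv : 𝔾.V ≃ ℍ.V
  /-- bijection on nodes -/
  nodeEquiv : 𝔾.N ≃ ℍ.N
  /-- bijection on cusps -/
  cuspEquiv : 𝔾.C ≃ ℍ.C
  nodeEnds_comm : ∀ e : 𝔾.N, ℍ.nodeEnds (nodeEquiv e) = (𝔾.nodeEnds e).map vertEquiv
  cuspEnd_comm : ∀ c : 𝔾.C, ℍ.cuspEnd (cuspEquiv c) = vertEquiv (𝔾.cuspEnd c)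

end PSCSemiGraph

/-! ### Pro-Σ groups -/

/-- A topological group `Π` is *pro-Σ* (for a set of primes `Σ`) if every prime dividing the order
of a FINITE quotient `Π/U`, `U` an open normal subgroup, lies in `Σ` ([CombGC] §1 p. 6: "`Ẑ^Σ` the
pro-Σ completion of `ℤ`"; Def. 1.1 (ii): "the maximal pro-Σ quotient of the profinite fundamental
group").  Stated for an arbitrary topological group (quotients that are not finite, whose `Nat.card`
is `0`, are excluded so that they impose nothing); intended for profinite `Π`, where every open
normal subgroup has finite index. [cite: MochizukiCombGC2007, Def 1.1(ii) p.6] -/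
@[mk_iff] structure IsProSigma (Sigma : Set ℕ) (P : Type u) [Group P] [TopologicalSpace P] :
    Prop where
  prime_mem : ∀ U : OpenNormalSubgroup P, Finite (P ⧸ U.toSubgroup) →
    ∀ p : ℕ, p.Prime → p ∣ Nat.card (P ⧸ U.toSubgroup) → p ∈ Sigma

/-! ### The interface: Definition 1.1 (ii) as data over a topological group `Π` -/

/-- **[CombGC] Definition 1.1 as an interface.**  A `PSCDatum Π` is the datum that a semi-graph of
anabelioids `G` *of pro-Σ PSC-type* (Def. 1.1 (i), p. 6) with PSC-fundamental group `Π_G = Π`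
(Def. 1.1 (ii), p. 6: "the maximal pro-Σ quotient of the profinite fundamental group of `G`")
determines: its underlying semi-graph `𝔾`; for each vertex `v` (resp. node `e`, cusp `c`) ONE
representative of the conjugacy class of closed subgroups it determines ("A vertex (respectively,
edge) of `𝔾` determines, up to conjugation, a closed subgroup of `Π_G`; we shall refer to such
subgroups as verticial (respectively, edge-like). An edge-like subgroup that arises from a closed
edge will be referred to as nodal; … from an open edge … cuspidal", pp. 6–7); the set of primes
`Σ`; and the genera of the irreducible components (Rmk. 1.1.5, p. 8).  The Prop-valued fields are
the properties §1 uses tacitly: the subgroups are closed; each branch of an edge abutting to a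
vertex gives (the conjugacy class of) an inclusion `Π_e ↪ Π_v` (the morphisms of anabelioids
`G_e → G_v` of a semi-graph of anabelioids, [CombGC] p. 6 / [SemiAnbd] Def. 2.1); `Π` is pro-Σ.
INTERFACE BOUNDARY: that every semi-graph of anabelioids of PSC-type yields such a datum, and the
deeper structure of `Π_v`, `Π_e` (Rmk. 1.1.3: `Π_e ≅ Ẑ^Σ`, `Π_v` nonabelian, `Π_G` centre-free),
are not asserted here. -- TODO-merge: abc-iut-L3-t1 (semi-graphs of anabelioids, [SemiAnbd] §2).
[cite: MochizukiCombGC2007, Def 1.1(ii) pp.6-7] -/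
structure PSCDatum (P : Type u) [Group P] [TopologicalSpace P] : Type (u + 1) where
  /-- the set of primes `Σ` ("of pro-Σ PSC-type") -/
  Sigma : Set ℕ
  sigma_prime : ∀ p ∈ Sigma, p.Prime
  sigma_nonempty : Sigma.Nonempty
  /-- the underlying semi-graph `𝔾` -/
  graph : PSCSemiGraph
  /-- a representative verticial subgroup `Π_v` for each vertex -/
  vertGp : graph.V → Subgroup P
  /-- a representative nodal (edge-like) subgroup `Π_e` for each node -/
  nodeGp : graph.N → Subgroup P
  /-- a representative cuspidal (edge-like) subgroup `Π_c` for each cusp -/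
  cuspGp : graph.C → Subgroup P
  /-- genus of the irreducible component indexed by `v` (Rmk. 1.1.5, p. 8) -/
  genus : graph.V → ℕ
  isClosed_vertGp : ∀ v, IsClosed (vertGp v : Set P)
  isClosed_nodeGp : ∀ e, IsClosed (nodeGp e : Set P)
  isClosed_cuspGp : ∀ c, IsClosed (cuspGp c : Set P)
  /-- each of the two branches of a node `e` joining `v₁`, `v₂` gives an inclusion of a conjugate
  of `Π_e` into `Π_{v₁}`, resp. `Π_{v₂}` -/
  nodeGp_le : ∀ e, ∃ v₁ v₂ : graph.V, graph.nodeEnds e = s(v₁, v₂) ∧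
    (∃ γ : ConjAct P, γ • nodeGp e ≤ vertGp v₁) ∧ (∃ γ : ConjAct P, γ • nodeGp e ≤ vertGp v₂)
  /-- the verticial branch of a cusp `c` gives an inclusion of a conjugate of `Π_c` into `Π_v` -/
  cuspGp_le : ∀ c, ∃ γ : ConjAct P, γ • cuspGp c ≤ vertGp (graph.cuspEnd c)
  /-- `Π_G` is a pro-Σ group -/
  proSigma : IsProSigma Sigma P

namespace PSCDatum

variable {P : Type u} [Group P] [TopologicalSpace P] (G : PSCDatum P)

/-! #### Verticial and edge-like subgroups (Def. 1.1 (ii), pp. 6–7) -/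

/-- `A` is a *verticial* subgroup of `Π_G`: a conjugate of some `Π_v` (p. 6).
[cite: MochizukiCombGC2007, Def 1.1(ii) p.6] -/
def IsVerticial (A : Subgroup P) : Prop := ∃ v : G.graph.V, ∃ γ : ConjAct P, A = γ • G.vertGp v

/-- `A` is a *nodal* (edge-like) subgroup: a conjugate of some `Π_e`, `e` a node (p. 7).
[cite: MochizukiCombGC2007, Def 1.1(ii) p.7] -/
def IsNodal (A : Subgroup P) : Prop := ∃ e : G.graph.N, ∃ γ : ConjAct P, A = γ • G.nodeGp e

/-- `A` is a *cuspidal* (edge-like) subgroup: a conjugate of some `Π_c`, `c` a cusp (p. 7).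
[cite: MochizukiCombGC2007, Def 1.1(ii) p.7] -/
def IsCuspidal (A : Subgroup P) : Prop := ∃ c : G.graph.C, ∃ γ : ConjAct P, A = γ • G.cuspGp c

/-- `A` is an *edge-like* subgroup: nodal or cuspidal (pp. 6–7).
[cite: MochizukiCombGC2007, Def 1.1(ii) pp.6-7] -/
def IsEdgeLike (A : Subgroup P) : Prop := G.IsNodal A ∨ G.IsCuspidal A

/-! #### Finite étale `Π_G`-coverings as open subgroups; their cusps, nodes, vertices

"We shall refer to a finite étale covering of `G` that arises from an open subgroup of `Π_G` as a
[finite étale] `Π_G`-covering of `G`" (Def. 1.1 (ii), p. 6).  For an open subgroup `H`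
(the covering `G_H → G`) the cusps of `G_H` lying over the cusp `c` are the `H`-orbits in
`Π/Π_c`, i.e. the double cosets `H \ Π / Π_c`; likewise for nodes and vertices. -/

/-- `r(G_H)`: the number of cusps of the `Π_G`-covering attached to the open subgroup `H`
(for `H = ⊤` this is `r(G)`).  Defined for every subgroup `H`; the intended reading is for `H` OPEN
(of finite index in profinite `Π_G`), where the double-coset spaces are finite; for other `H` an
infinite double-coset space contributes `Nat.card = 0`. [cite: MochizukiCombGC2007, Def 1.1(i)-(ii) p.6] -/
noncomputable def cuspCount (H : Subgroup P) : ℕ :=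
  ∑ c : G.graph.C, Nat.card (DoubleCoset.Quotient (H : Set P) (G.cuspGp c : Set P))

/-- `n(G_H)`: the number of nodes of the covering attached to `H` (intended for open `H`, as for
`cuspCount`). [cite: MochizukiCombGC2007, Def 1.1(i)-(ii) p.6] -/
noncomputable def nodeCount (H : Subgroup P) : ℕ :=
  ∑ e : G.graph.N, Nat.card (DoubleCoset.Quotient (H : Set P) (G.nodeGp e : Set P))

/-- `i(G_H)`: the number of vertices of the covering attached to `H` (intended for open `H`, as
for `cuspCount`). [cite: MochizukiCombGC2007, Def 1.1(i)-(ii) p.6] -/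
noncomputable def vertCount (H : Subgroup P) : ℕ :=
  ∑ v : G.graph.V, Nat.card (DoubleCoset.Quotient (H : Set P) (G.vertGp v : Set P))

/-- `deg(G_H / G) = [Π_G : H]`. [cite: MochizukiCombGC2007, Rmk 1.4.2 p.11] -/
noncomputable def degree (H : Subgroup P) : ℕ := H.index

/-- The verticial subgroups of `Π_{G_H} = H`: the `H ⊓ Π_v^γ` (stabilizers in `H` of vertices of
the universal covering). [cite: MochizukiCombGC2007, Def 1.1(ii) p.6] -/
def IsVerticialIn (H A : Subgroup P) : Prop := ∃ B, G.IsVerticial B ∧ A = H ⊓ B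

/-- The edge-like subgroups of `Π_{G_H} = H`: the `H ⊓ Π_e^γ`. [cite: MochizukiCombGC2007, Def 1.1(ii) p.6] -/
def IsEdgeLikeIn (H A : Subgroup P) : Prop := ∃ B, G.IsEdgeLike B ∧ A = H ⊓ B

/-- The cuspidal subgroups of `Π_{G_H} = H`: the `H ⊓ Π_c^γ`. [cite: MochizukiCombGC2007, Def 1.1(ii) p.7] -/
def IsCuspidalIn (H A : Subgroup P) : Prop := ∃ B, G.IsCuspidal B ∧ A = H ⊓ B

/-- The nodal subgroups of `Π_{G_H} = H`: the `H ⊓ Π_e^γ`, `e` a node. [cite: MochizukiCombGC2007, Def 1.1(ii) p.7] -/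
def IsNodalIn (H A : Subgroup P) : Prop := ∃ B, G.IsNodal B ∧ A = H ⊓ B

section Closures

variable [IsTopologicalGroup P]

/-! #### The filtration `M^cusp ⊆ M^edge ⊆ M^vert ⊆ M_G` (Def. 1.1 (ii), p. 7)

"Write `M_G` for the abelianization of `Π_G`. Then the cuspidal, edge-like, and verticial subgroups
of `Π_G` determine submodules `M^cusp_G ⊆ M^edge_G ⊆ M^vert_G ⊆ M_G`".  For the covering attached
to an open subgroup `H` (so `M_{G_H} = H^ab`, the quotient of `H` by the closure of `[H, H]`) we
record each submodule by its inverse image in `H`, a closed subgroup of `Π` between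
`closure [H,H]` and `H`. -/

/-- Inverse image in `H` of `M^vert_{G_H} ⊆ M_{G_H}`: the closed subgroup generated by `[H, H]` and
the verticial subgroups of `H`. [cite: MochizukiCombGC2007, Def 1.1(ii) p.7] -/
def vertFil (H : Subgroup P) : Subgroup P :=
  (⁅H, H⁆ ⊔ ⨆ A : {A : Subgroup P // G.IsVerticialIn H A}, (A : Subgroup P)).topologicalClosure

/-- Inverse image in `H` of `M^edge_{G_H}`. [cite: MochizukiCombGC2007, Def 1.1(ii) p.7] -/
def edgeFil (H : Subgroup P) : Subgroup P :=
  (⁅H, H⁆ ⊔ ⨆ A : {A : Subgroup P // G.IsEdgeLikeIn H A}, (A : Subgroup P)).topologicalClosure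

/-- Inverse image in `H` of `M^cusp_{G_H}`. [cite: MochizukiCombGC2007, Def 1.1(ii) p.7] -/
def cuspFil (H : Subgroup P) : Subgroup P :=
  (⁅H, H⁆ ⊔ ⨆ A : {A : Subgroup P // G.IsCuspidalIn H A}, (A : Subgroup P)).topologicalClosure

/-- A cyclic finite étale covering `G_{H'} → G_H` (open subgroups `H' ≤ H`, `H'` normal in `H` with
`H/H'` cyclic, recorded as: `H` is generated by `H'` and one element) is *module-wise nodal* if it
"arises from a finite quotient `M_{G_H} ↠ Q` that factors through `M/M^cusp` and induces a
surjection `M^edge/M^cusp ↠ Q`" (p. 7): `H'` contains the inverse image of `M^cusp_{G_H}` and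
`H` is generated by `H'` together with the inverse image of `M^edge_{G_H}`.  Intended for OPEN
subgroups `H' ≤ H` (a finite cyclic covering); openness is not part of the predicate and is added
as a hypothesis where the statements need it. [cite: MochizukiCombGC2007, Def 1.1(ii) p.7] -/
def IsModulewiseNodal (H H' : Subgroup P) : Prop :=
  H' ≤ H ∧ (H'.subgroupOf H).Normal ∧ (∃ g ∈ H, H' ⊔ Subgroup.zpowers g = H) ∧
    G.cuspFil H ≤ H' ∧ H' ⊔ G.edgeFil H = H

/-! #### The quotients `Π_G ↠ Π^cpt_G ↠ Π^unr_G ↠ Π^grph_G` (Def. 1.1 (ii), p. 7) -/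

/-- Kernel of `Π_G ↠ Π^cpt_G`: the closed normal subgroup generated by the cuspidal subgroups
("compactified quotient", p. 7). [cite: MochizukiCombGC2007, Def 1.1(ii) p.7] -/
def cptKer : Subgroup P := (Subgroup.normalClosure (⋃ c, (G.cuspGp c : Set P))).topologicalClosure

/-- Kernel of `Π_G ↠ Π^unr_G`: the closed normal subgroup generated by the edge-like subgroups
("unramified quotient", p. 7). [cite: MochizukiCombGC2007, Def 1.1(ii) p.7] -/
def unrKer : Subgroup P :=
  (Subgroup.normalClosure ((⋃ c, (G.cuspGp c : Set P)) ∪ ⋃ e, (G.nodeGp e : Set P))).topologicalClosure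

/-- Kernel of `Π_G ↠ Π^grph_G`: the closed normal subgroup generated by the verticial subgroups
("graph-theoretic quotient", p. 7). [cite: MochizukiCombGC2007, Def 1.1(ii) p.7] -/
def grphKer : Subgroup P := (Subgroup.normalClosure (⋃ v, (G.vertGp v : Set P))).topologicalClosure

/-- A `Π_G`-covering (open subgroup `H`) is a `Π^unr_G`-covering if it "arises from an open subgroup
of `Π^unr_G`", i.e. `H ⊇ Ker(Π_G ↠ Π^unr_G)` (p. 7). [cite: MochizukiCombGC2007, Def 1.1(ii) p.7] -/
def IsUnrCovering (H : Subgroup P) : Prop := G.unrKer ≤ H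

/-- A `Π_G`-covering is a `Π^cpt_G`-covering if `H ⊇ Ker(Π_G ↠ Π^cpt_G)` (p. 7).
[cite: MochizukiCombGC2007, Def 1.1(ii) p.7] -/
def IsCptCovering (H : Subgroup P) : Prop := G.cptKer ≤ H

/-- The *unramified verticial* subgroups: images in `Π^unr_G = Π/unrKer` of the verticial subgroups,
recorded as the subgroups `Π_v^γ · unrKer` of `Π` (p. 7). [cite: MochizukiCombGC2007, Def 1.1(ii) p.7] -/
def IsUnrVerticial (B : Subgroup P) : Prop := ∃ A, G.IsVerticial A ∧ B = A ⊔ G.unrKer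

/-- *Sturdy*, typed through Remark 1.1.5 (p. 8): "the condition that a semi-graph of anabelioids
`G` of PSC-type be sturdy corresponds to the condition that every irreducible component of the
pointed stable curve that gives rise to `G` be of genus ≥ 2".  (Def. 1.1 (ii), p. 7, prints: "the
abelianization of every unramified verticial subgroup of `Π^unr_G` is free of rank ≥ 2 over `Ẑ^Σ`"
— a misprint: Hoshi–Mochizuki [CbTpII] Rmk. 1.1.2 (bib `HoshiMochizukiCbTpII2022`, authors' ms
p. 19): "the phrase 'rank ≥ 2' should read 'rank > 2' … `G` is sturdy if and only if every vertex of
`G` is of genus ≥ 2".)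
[cite: MochizukiCombGC2007, Rmk 1.1.5 p.8] -/
def IsSturdy (G : PSCDatum P) : Prop := ∀ v : G.graph.V, 2 ≤ G.genus v

/-- The kernels are nested: `cptKer ≤ unrKer`. [cite: MochizukiCombGC2007, Def 1.1(ii) p.7] -/
theorem cptKer_le_unrKer : G.cptKer ≤ G.unrKer := by
  refine Subgroup.topologicalClosure_mono (Subgroup.normalClosure_mono ?_)
  exact Set.subset_union_left

omit [IsTopologicalGroup P] in
/-- A subgroup with a conjugate inside some `Π_v` lies in the normal closure of the verticial
subgroups (branch inclusions of Def. 1.1). [cite: MochizukiCombGC2007, Def 1.1(ii) p.7] -/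
private theorem le_normalClosure_vert_of_conj_le {A : Subgroup P} {v : G.graph.V} {γ : ConjAct P}
    (h : γ • A ≤ G.vertGp v) : (A : Set P) ⊆ Subgroup.normalClosure (⋃ w, (G.vertGp w : Set P)) :=
  fun a ha => by
    simpa [ConjAct.smul_def, mul_assoc] using
      (Subgroup.normalClosure_normal (s := ⋃ w, (G.vertGp w : Set P))).conj_mem _
        (Subgroup.subset_normalClosure
          (Set.mem_iUnion.mpr ⟨v, h (Subgroup.smul_mem_pointwise_smul a γ A ha)⟩))
        (ConjAct.ofConjAct γ)⁻¹

/-- The kernels are nested: `unrKer ≤ grphKer` (every edge-like subgroup has a conjugate inside a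
verticial subgroup: the branch inclusions `Π_e ↪ Π_v`). [cite: MochizukiCombGC2007, Def 1.1(ii) p.7] -/
theorem unrKer_le_grphKer : G.unrKer ≤ G.grphKer := by
  refine Subgroup.topologicalClosure_mono (Subgroup.normalClosure_le_normal ?_)
  rintro a (ha | ha)
  · obtain ⟨c, hc⟩ := Set.mem_iUnion.mp ha
    obtain ⟨γ, hγ⟩ := G.cuspGp_le c
    exact G.le_normalClosure_vert_of_conj_le hγ hc
  · obtain ⟨e, he⟩ := Set.mem_iUnion.mp ha
    obtain ⟨v₁, v₂, -, ⟨γ, hγ⟩, -⟩ := G.nodeGp_le e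
    exact G.le_normalClosure_vert_of_conj_le hγ he

end Closures

/-! "Commensurably terminal" (`C_G(H) = H`, [CombGC] §0 p. 3) is NOT re-declared here: the cell's
home for it is `AbsoluteAnabelian.ProfiniteTerminology.IsCommensurablyTerminal` (seat L4-t4);
`PSCGraphicity.lean` writes `Subgroup.Commensurable.commensurator H = H` directly. -/

/-! #### Sanity lemmas: for the trivial covering the counts are those of `𝔾` -/

omit [TopologicalSpace P] in
/-- Over the trivial covering `H = Π` there is exactly one double coset `Π \ Π / K`. [folklore] -/
private theorem card_doubleCoset_univ (K : Subgroup P) :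
    Nat.card (DoubleCoset.Quotient (Set.univ : Set P) (K : Set P)) = 1 := by
  rw [← Subgroup.coe_top]
  haveI : Subsingleton (DoubleCoset.Quotient ((⊤ : Subgroup P) : Set P) (K : Set P)) :=
    ⟨fun a b => by
      rw [← DoubleCoset.out_eq' ⊤ K a, ← DoubleCoset.out_eq' ⊤ K b, DoubleCoset.eq]
      exact ⟨b.out * a.out⁻¹, Subgroup.mem_top _, 1, K.one_mem, by simp⟩⟩
  exact Nat.card_unique

/-- `r(G_Π) = r(G)`: the trivial covering has `card C` cusps. [cite: MochizukiCombGC2007, Def 1.1(i) p.6] -/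
theorem cuspCount_top : G.cuspCount ⊤ = G.graph.r := by
  simp [cuspCount, PSCSemiGraph.r, card_doubleCoset_univ]

/-- `n(G_Π) = n(G)`. [cite: MochizukiCombGC2007, Def 1.1(i) p.6] -/
theorem nodeCount_top : G.nodeCount ⊤ = G.graph.n := by
  simp [nodeCount, PSCSemiGraph.n, card_doubleCoset_univ]

/-- `i(G_Π) = i(G)`. [cite: MochizukiCombGC2007, Def 1.1(i) p.6] -/
theorem vertCount_top : G.vertCount ⊤ = G.graph.i := by
  simp [vertCount, PSCSemiGraph.i, card_doubleCoset_univ]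

end PSCDatum

end Literature.AnabelianGeometry.SemiGraphs
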